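import Mathlib
import Summits.MatrixMultiplication.MatrixMultiplication.Theses.GLnSeparatingDesigns
import Summits.MatrixMultiplication.MatrixMultiplication.Theorems.GLnSeparatingDesignsSeparationDegreeCost

/-!
# F3 / BC5 WITNESS for the line `simultaneous_separation_cost` under crux `BorderHalfDimensionDesigns`
# (stmt-MatrixMultiplication-18360, route route-MatrixMultiplication-GLnSeparatingDesigns)

The rung `SimultaneousSeparationDegreeCost = ∀ k, Rung k` (graded by the number `k` of TPP triples)
SPECIALISES at the floor parameter `k = 1` to the PROVED crux `GLnSeparatingDesigns.SeparationDegreeCost`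
(stmt-MatrixMultiplication-18361, `Summit.MatrixMultiplication.MatrixMultiplication.Theorems.SeparationDegreeCost_of`,
sorry-free, axioms standard): `rung_one : Rung 1`.  No sorry.  (`Rung` is copied verbatim from
`Lines/simultaneous_separation_cost.lean` so that this file elaborates on its own; the same theorem is
`SimultaneousSeparationCost.rung_one` there.)
-/

set_option linter.dupNamespace false

namespace Summit.MatrixMultiplication.MatrixMultiplication.Cruxes.BorderHalfDimensionDesigns.SimultaneousSeparationCost.Special

open scoped BigOperators
open Literature.Computability.AlgebraicComplexity

/-- graded family of the ladder (verbatim copy of `SimultaneousSeparationCost.Rung`): the simultaneous border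
separation-degree price for families of `k` TPP triples in `GL_n(ℂ)`. -/
def Rung (k : ℕ) : Prop :=
  ∀ n : ℕ, 3 ≤ n → ∀ s : ℕ, 2 ≤ s → ∀ N₁ N₂ N₃ : Fin k → ℕ,
    (∀ η : ℝ, 0 < η → ∃ X Y Z : Fin k → Finset (Matrix.GeneralLinearGroup (Fin n) ℂ),
      (∀ i, N₁ i ≤ (X i).card ∧ N₂ i ≤ (Y i).card ∧ N₃ i ≤ (Z i).card) ∧
      (∀ i, ∀ x ∈ X i, ∀ x' ∈ X i, ∀ y ∈ Y i, ∀ y' ∈ Y i, ∀ z ∈ Z i, ∀ z' ∈ Z i,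
        x * y⁻¹ * y' * z⁻¹ = x' * z'⁻¹ → x = x' ∧ y = y' ∧ z = z') ∧
      ∀ i₀, ∀ x₀ ∈ X i₀, ∀ z₀ ∈ Z i₀, ∃ p : MvPolynomial (Fin n × Fin n) ℂ, p.totalDegree ≤ s ∧
        ∀ i j, ∀ x ∈ X i, ∀ y ∈ Y i, ∀ y' ∈ Y j, ∀ z ∈ Z j,
          ((i = i₀ ∧ j = i₀ ∧ x = x₀ ∧ y = y' ∧ z = z₀) →
            ‖MvPolynomial.eval (fun ij : Fin n × Fin n =>
                ((x * y⁻¹ * y' * z⁻¹ : Matrix.GeneralLinearGroup (Fin n) ℂ) : Matrix (Fin n) (Fin n) ℂ)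
                  ij.1 ij.2) p - 1‖ ≤ η) ∧
          (¬ (i = i₀ ∧ j = i₀ ∧ x = x₀ ∧ y = y' ∧ z = z₀) →
            ‖MvPolynomial.eval (fun ij : Fin n × Fin n =>
                ((x * y⁻¹ * y' * z⁻¹ : Matrix.GeneralLinearGroup (Fin n) ℂ) : Matrix (Fin n) (Fin n) ℂ)
                  ij.1 ij.2) p‖ ≤ η)) →
    ∑ i, ((N₁ i : ℝ) * N₂ i * N₃ i) ^ (omega ℂ / 3) ≤
      (s : ℝ) ^ ((n : ℝ) * (n - 1) / 2 * (omega ℂ - 2)) * ((s + n ^ 2).choose (n ^ 2) : ℝ)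

/-- **Witness: the rung at the floor parameter `k = 1` is the proved crux `SeparationDegreeCost`.** -/
theorem rung_one : Rung 1 := by
  intro n hn s hs N₁ N₂ N₃ hdes
  have hfloor := Summit.MatrixMultiplication.MatrixMultiplication.Theorems.SeparationDegreeCost_of
    n hn s hs (N₁ 0) (N₂ 0) (N₃ 0) (fun η hη => by
      obtain ⟨X, Y, Z, hcard, htpp, hsep⟩ := hdes η hη
      refine ⟨X 0, Y 0, Z 0, (hcard 0).1, (hcard 0).2.1, (hcard 0).2.2, htpp 0, ?_⟩
      intro x₀ hx₀ z₀ hz₀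
      obtain ⟨p, hp, hps⟩ := hsep 0 x₀ hx₀ z₀ hz₀
      refine ⟨p, hp, fun x hx y hy y' hy' z hz => ?_⟩
      have h := hps 0 0 x hx y hy y' hy' z hz
      exact ⟨fun hc => h.1 ⟨rfl, rfl, hc⟩, fun hc => h.2 fun h' => hc h'.2.2⟩)
  rw [Fin.sum_univ_one]
  exact hfloor

/-- The floor itself, by name (the k = 1 rung IS `SeparationDegreeCost` up to `Fin 1` bookkeeping). -/
theorem floor : Summit.MatrixMultiplication.MatrixMultiplication.Theses.GLnSeparatingDesigns.SeparationDegreeCost :=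
  Summit.MatrixMultiplication.MatrixMultiplication.Theorems.SeparationDegreeCost_of

end Summit.MatrixMultiplication.MatrixMultiplication.Cruxes.BorderHalfDimensionDesigns.SimultaneousSeparationCost.Special
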